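import Literature.Analysis.FluidPDE.IteratedSliceDerivatives
import Literature.Analysis.FluidPDE.VectorCalculus
import HarnessLib

/-!
# The word commutator `[D_w, a·∇] b` of the convective derivative: pointwise calculus

Topic `Literature/Analysis/FluidPDE`. Pointwise identities for the commutator of an iterated
directional derivative `D_w` (the tree's `iterDeriv`, `IteratedSliceDerivatives.lean`) with the
convective derivative `(a·∇) b = Db(a)` (`convect`, `VectorCalculus.lean`):

`convectCommutator m v a b = D_v ((a·∇) b) − (a·∇)(D_v b)`,

for `C^∞` fields on an open set. This is the "difference term" of Ferrari's `D^α`-energy identity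
(A. B. Ferrari, Comm. Math. Phys. **155** (1993), (8) p. 280: `u·D^α∇u − D^α(u·∇u)`), which the
sibling file `Ferrari1993EnergyIdentity.lean` calls `convectionCommutator m w v` for `a = b = v`
and words `w` in the basis of the tree's Sobolev norm (`= convectCommutator m (sobolevDir w) v v`,
definitionally). We prove the **Leibniz recursion**
(`convectCommutator_succ_eqOn`): on an open set `U` where `a, b` are `C^∞`,

`[D_{e·v'}, a·∇] b = (∂ₑa·∇)(D_{v'} b) + [D_{v'}, ∂ₑa·∇] b + [D_{v'}, a·∇](∂ₑ b)`,

from `∂ₑ((a·∇)b) = (∂ₑa·∇) b + (a·∇)(∂ₑ b)` (`fderiv_convect_apply_eqOn`, by the symmetry of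
second derivatives), together with `[D_∅, a·∇] b = 0`. Unrolled, for a word of length `m` the
commutator is the sum over the `2^m − 1` nonempty sub-words `β` of `(D_β a·∇)(D_{w∖β} b)`
(Ferrari's Lemma 1 (ii) estimates exactly these products); the recursion is the form in which the
`L²` estimates are proved (`Ferrari1993CommutatorEstimate.lean`). All statements are folklore
calculus.
-/

noncomputable section

open Set Function Filter Topology
open scoped ContDiff

namespace Literature.Analysis.FluidPDE

variable {E : Type*} [NormedAddCommGroup E] [InnerProductSpace ℝ E]
variable {F : Type*} [NormedAddCommGroup F] [InnerProductSpace ℝ F]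

/-! ### Smoothness of convective derivatives -/

/-- `(a·∇) b` is `C^∞` on an open set where `a` and `b` are. [folklore] -/
theorem contDiffOn_convect_of_isOpen' {U : Set E} (hU : IsOpen U) {a : E → E} {b : E → F}
    (ha : ContDiffOn ℝ ∞ a U) (hb : ContDiffOn ℝ ∞ b U) : ContDiffOn ℝ ∞ (convect a b) U := by
  have h := ((contDiffOn_infty_iff_fderiv_of_isOpen hU).1 hb).2.clm_apply ha
  exact h.congr fun x _ => rfl

/-- **`∂ₑ((a·∇)b) = (∂ₑa·∇) b + (a·∇)(∂ₑ b)`** on an open set of smoothness (product rule for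
`x ↦ Db(x)(a x)` and the symmetry `D²b(e, a) = D²b(a, e)`). [folklore] -/
theorem fderiv_convect_apply_eqOn {U : Set E} (hU : IsOpen U) {a : E → E} {b : E → F}
    (ha : ContDiffOn ℝ ∞ a U) (hb : ContDiffOn ℝ ∞ b U) (e : E) :
    EqOn (fun x => fderiv ℝ (convect a b) x e)
      (fun x => convect (fun y => fderiv ℝ a y e) b x + convect a (fun y => fderiv ℝ b y e) x) U := by
  intro x hx
  have hbx : ContDiffAt ℝ ∞ b x := hb.contDiffAt (hU.mem_nhds hx)
  have hb2 : ContDiffAt ℝ 2 b x := hbx.of_le (WithTop.coe_le_coe.mpr le_top)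
  have hDb : DifferentiableAt ℝ (fderiv ℝ b) x :=
    (hb2.fderiv_right (m := 1) le_rfl).differentiableAt one_ne_zero
  have hax : DifferentiableAt ℝ a x := differentiableAt_of_contDiffOn_isOpen hU ha hx
  simp only [show convect a b = fun y => fderiv ℝ b y (a y) from rfl]
  rw [fderiv_clm_apply hDb hax]
  simp only [_root_.add_apply, ContinuousLinearMap.coe_comp, comp_apply,
    ContinuousLinearMap.flip_apply]
  congr 1
  -- `D²b(e)(a x) = D(∂_{a x} b) e = D(∂ₑ b)(a x)`
  have h1 : fderiv ℝ (fun z => fderiv ℝ b z (a x)) x = (fderiv ℝ (fderiv ℝ b) x).flip (a x) := by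
    rw [fderiv_clm_apply hDb (differentiableAt_const (a x)), fderiv_const_apply]
    simp
  have h2 : fderiv ℝ (fderiv ℝ b) x e (a x) = fderiv ℝ (fun z => fderiv ℝ b z (a x)) x e := by
    rw [h1, ContinuousLinearMap.flip_apply]
  rw [h2, fderiv_fderiv_apply_comm_of_contDiffAt hbx e (a x)]
  rfl

/-! ### The word commutator and its recursion -/

/-- **The word commutator** `[D_v, a·∇] b = D_v((a·∇)b) − (a·∇)(D_v b)` of the iterated directional
derivative along the word `v` with the convective derivative (Ferrari 1993, (8): the difference
term `u·D^α∇u − D^α(u·∇u)`; for `a = b` and basis words this is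
`Ferrari1993EnergyIdentity.convectionCommutator`). Classical derivatives (junk where `fderiv` is).
[folklore] -/
def convectCommutator (m : ℕ) (v : Fin m → E) (a : E → E) (b : E → F) : E → F :=
  fun x => iterDeriv m v (convect a b) x - fderiv ℝ (iterDeriv m v b) x (a x)

/-- Unfolding `convectCommutator`. [folklore] -/
theorem convectCommutator_apply (m : ℕ) (v : Fin m → E) (a : E → E) (b : E → F) (x : E) :
    convectCommutator m v a b x = iterDeriv m v (convect a b) x - fderiv ℝ (iterDeriv m v b) x (a x) :=
  rfl

/-- The empty word: `[D_∅, a·∇] b = 0`. [folklore] -/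
@[simp]
theorem convectCommutator_zero (v : Fin 0 → E) (a : E → E) (b : E → F) :
    convectCommutator 0 v a b = 0 := by
  funext x
  simp [convectCommutator]

/-- **The Leibniz recursion of the word commutator**: on an open set `U` where `a, b` are `C^∞`,
`[D_{(e, v')}, a·∇] b = (∂ₑa·∇)(D_{v'} b) + [D_{v'}, ∂ₑa·∇] b + [D_{v'}, a·∇](∂ₑ b)` for the word
`v = (e, v')` (`e = v 0`, `v' = tail v`). [folklore] -/
theorem convectCommutator_succ_eqOn {U : Set E} (hU : IsOpen U) (m : ℕ) (v : Fin (m + 1) → E)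
    {a : E → E} {b : E → F} (ha : ContDiffOn ℝ ∞ a U) (hb : ContDiffOn ℝ ∞ b U) :
    EqOn (convectCommutator (m + 1) v a b)
      (fun x => convect (fun y => fderiv ℝ a y (v 0)) (iterDeriv m (Fin.tail v) b) x +
        convectCommutator m (Fin.tail v) (fun y => fderiv ℝ a y (v 0)) b x +
        convectCommutator m (Fin.tail v) a (fun y => fderiv ℝ b y (v 0)) x) U := by
  intro x hx
  set a' : E → E := fun y => fderiv ℝ a y (v 0) with ha'
  set b' : E → F := fun y => fderiv ℝ b y (v 0) with hb'
  have ha's : ContDiffOn ℝ ∞ a' U := contDiffOn_fderiv_apply_of_isOpen hU ha (v 0)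
  have hb's : ContDiffOn ℝ ∞ b' U := contDiffOn_fderiv_apply_of_isOpen hU hb (v 0)
  have hc1 : ContDiffOn ℝ ∞ (convect a' b) U := contDiffOn_convect_of_isOpen' hU ha's hb
  have hc2 : ContDiffOn ℝ ∞ (convect a b') U := contDiffOn_convect_of_isOpen' hU ha hb's
  simp only [convectCommutator_apply, iterDeriv_succ]
  have h1 : EqOn (fun y => fderiv ℝ (convect a b) y (v 0)) (fun y => convect a' b y + convect a b' y) U :=
    fderiv_convect_apply_eqOn hU ha hb (v 0)
  rw [iterDeriv_congr_of_isOpen hU m (Fin.tail v) h1 hx,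
    iterDeriv_add_of_isOpen hU m (Fin.tail v) hc1 hc2 hx]
  simp only [convect_apply]
  abel

/-- The one-letter commutator: `[∂ₑ, a·∇] b = (∂ₑa·∇) b` on an open set of smoothness. [folklore] -/
theorem convectCommutator_one_eqOn {U : Set E} (hU : IsOpen U) (v : Fin 1 → E)
    {a : E → E} {b : E → F} (ha : ContDiffOn ℝ ∞ a U) (hb : ContDiffOn ℝ ∞ b U) :
    EqOn (convectCommutator 1 v a b) (convect (fun y => fderiv ℝ a y (v 0)) b) U := by
  intro x hx
  rw [convectCommutator_succ_eqOn hU 0 v ha hb hx]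
  simp

end Literature.Analysis.FluidPDE
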